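import Literature.Computability.FineGrained.SerfKSatPost
import Literature.Computability.FineGrained.CompactionMachine
import Literature.Computability.Complexity.TM2Context
import HarnessLib

/-!
# SERF reduction of `k`-SAT (parameter `n`) to `k`-SAT (parameter `m`), IV: the step machine

Family `fine-grained`. Fourth file of the machine behind
`Literature.Computability.FineGrained.serfReducible_kSATParam_kSATClauseParam` (Impagliazzo–Paturi–Zane,
JCSS 63 (2001), §2, Cor. 1–2). The step function of the oracle algorithm of the SERF reduction —
input `⟨x, transcript⟩`, output a query or an answer in the format of `SERFReducible` — is computed
by the sequential composite (`Turing.TM2ComputableAux.comp`, additive time) of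

1. the input splitter `inT` (`SerfKSatFST.lean`);
2. the Boolean front end `preFn k` (`SerfKSatPre.lean`, polynomial time) run on the first field by
   the context machine `TM2Ctx.ctxTM` (`ctx_outputsWithin`: time linear in the context);
3. the hand-over transducer `midT`;
4. the compaction machine (`Compaction.kCNF_compact_computable_holds`) followed by a sparsifier
   machine (a hypothesis here: any machine computing `KCNF.encode φ ↦ KCNF.encodeList (F φ)`; the
   tree's `sparsification_holds` provides one for every `ε > 0`), again on the first field by the
   context machine;
5. the back end `Post.prog` (`SerfKSatPost.lean`);
6. the output projection `outT`.

Main result: `SerfKSat.exists_stepMachine` — a `TM2` machine over `Bool` computing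
`SerfKSat.stepBits k F x as` on `boolPair x (listBool-code of as)` within
`A (|x|+1)^A + A · T_F (compact (kcnfOf k x)) + A · |transcript|` steps: polynomial in the instance,
linear in the sparsifier's time on the compacted instance, and linear in the transcript.

## References

* R. Impagliazzo, R. Paturi, F. Zane, *Which problems have strongly exponential complexity?*,
  J. Comput. System Sci. 63 (2001) 512–530, §2, Cor. 1–2.
* S. Arora, B. Barak, *Computational Complexity: A Modern Approach*, CUP 2009, §1.3 (composition of
  machines; subroutines on multi-tape machines).
-/

noncomputable section

namespace Literature.Computability.FineGrained.SerfKSat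

open _root_.Computability Complexity Turing Polynomial

/-! ### The context machine with an arbitrary time bound -/

/-- **Running a machine on the first field, keeping the context** (`TM2Ctx.run_all`, repackaged
for `OutputsWithin`): if `Mx` maps `u` to `y` within `m` steps then the context machine maps
`u · none · ctx` to `y · none · ctx` within `2|u| + 2|ctx| + 2|y| + m + 8` steps — linear in the
context, whatever `m` is. [cite: AroraBarak2009, §1.3 (multi-tape machines; subroutines)] -/
theorem ctx_outputsWithin {A : Type} [Inhabited A] (Mx : TM2ComputableAux A A) {u y : List A} {m : ℕ}
    (ctx : List (Option A)) (h : Mx.OutputsWithin u y m) :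
    (TM2Ctx.ctxAux Mx).OutputsWithin (u.map some ++ none :: ctx) (y.map some ++ none :: ctx)
      (2 * u.length + 2 * ctx.length + 2 * y.length + m + 8) := by
  apply TM2Iter.outputsWithin_of_reachesIn
  have hin : (u.map some ++ none :: ctx).map (TM2Ctx.ctxAux Mx).inputAlphabet.symm = u.map some ++ none :: ctx :=
    List.map_id _
  have hout : (y.map some ++ none :: ctx).map (TM2Ctx.ctxAux Mx).outputAlphabet.symm = y.map some ++ none :: ctx :=
    List.map_id _
  rw [hin, hout]
  exact TM2Ctx.run_all Mx.tm Mx.inputAlphabet Mx.outputAlphabet ctx (TM2Iter.reachesIn_of_outputsWithin Mx h)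

/-! ### Polynomially bounded quantities -/

/-- `PolyBd f`: the quantity `f x` is at most `c (|x| + 1)^c` for some constant `c`. [folklore] -/
def PolyBd (f : List Bool → ℕ) : Prop := ∃ c : ℕ, ∀ x : List Bool, f x ≤ c * (x.length + 1) ^ c

namespace PolyBd

/-- Enlarging coefficient and degree. [folklore] -/
theorem bound_mono {c d : ℕ} (h : c ≤ d) (n : ℕ) : c * (n + 1) ^ c ≤ d * (n + 1) ^ d :=
  Nat.mul_le_mul h (Nat.pow_le_pow_right (Nat.succ_pos n) h)

/-- A pointwise smaller quantity. [folklore] -/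
theorem mono {f g : List Bool → ℕ} (hg : PolyBd g) (h : ∀ x, f x ≤ g x) : PolyBd f := by
  obtain ⟨c, hc⟩ := hg; exact ⟨c, fun x => (h x).trans (hc x)⟩

/-- Constants. [folklore] -/
theorem const (a : ℕ) : PolyBd fun _ => a :=
  ⟨a, fun x => by simpa using Nat.mul_le_mul_left a (Nat.one_le_pow a (x.length + 1) (Nat.succ_pos _))⟩

/-- The length. [folklore] -/
theorem length : PolyBd fun x => x.length := ⟨1, fun x => by simp⟩

/-- Sums. [folklore] -/
theorem add {f g : List Bool → ℕ} (hf : PolyBd f) (hg : PolyBd g) : PolyBd fun x => f x + g x := by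
  obtain ⟨c, hc⟩ := hf; obtain ⟨d, hd⟩ := hg
  refine ⟨c + d, fun x => ?_⟩
  have h1 := (hc x).trans (bound_mono (Nat.le_add_right c d) x.length)
  have h2 := (hd x).trans (bound_mono (Nat.le_add_left d c) x.length)
  calc f x + g x ≤ c * (x.length + 1) ^ (c + d) + d * (x.length + 1) ^ (c + d) := by
        have := Nat.pow_le_pow_right (Nat.succ_pos x.length) (Nat.le_add_right c d)
        have := Nat.pow_le_pow_right (Nat.succ_pos x.length) (Nat.le_add_left d c)
        nlinarith [hc x, hd x]
    _ = (c + d) * (x.length + 1) ^ (c + d) := by ring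

/-- Products. [folklore] -/
theorem mul {f g : List Bool → ℕ} (hf : PolyBd f) (hg : PolyBd g) : PolyBd fun x => f x * g x := by
  obtain ⟨c, hc⟩ := hf; obtain ⟨d, hd⟩ := hg
  refine ⟨c * d + (c + d), fun x => ?_⟩
  calc f x * g x ≤ (c * (x.length + 1) ^ c) * (d * (x.length + 1) ^ d) := Nat.mul_le_mul (hc x) (hd x)
    _ = (c * d) * (x.length + 1) ^ (c + d) := by ring
    _ ≤ (c * d + (c + d)) * (x.length + 1) ^ (c * d + (c + d)) :=
        Nat.mul_le_mul (Nat.le_add_right _ _) (Nat.pow_le_pow_right (Nat.succ_pos _) (Nat.le_add_left _ _))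

/-- Powers. [folklore] -/
theorem pow {f : List Bool → ℕ} (hf : PolyBd f) : ∀ n : ℕ, PolyBd fun x => f x ^ n
  | 0 => by simpa using const 1
  | n + 1 => by simpa [pow_succ] using (pow hf n).mul hf

/-- Constant multiples. [folklore] -/
theorem const_mul {f : List Bool → ℕ} (hf : PolyBd f) (a : ℕ) : PolyBd fun x => a * f x := (const a).mul hf

/-- Adding a constant. [folklore] -/
theorem add_const {f : List Bool → ℕ} (hf : PolyBd f) (a : ℕ) : PolyBd fun x => f x + a := hf.add (const a)

/-- Polynomials of polynomially bounded quantities. [folklore] -/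
theorem poly {f : List Bool → ℕ} (hf : PolyBd f) (p : Polynomial ℕ) : PolyBd fun x => p.eval (f x) := by
  induction p using Polynomial.induction_on' with
  | add p q hp hq => simpa using hp.add hq
  | monomial n a => simpa using (const a).mul (hf.pow n)

end PolyBd

/-! ### The step function computed -/

variable (k : ℕ) (F : KCNF k → List (KCNF k))

/-- The sparse formulas queried on input `x`: the sparsifier applied to the compaction of the
formula handed over. [cite: ImpagliazzoPaturiZane2001, §2, Cor. 1–2] -/
def sparse (x : List Bool) : List (KCNF k) := F (KCNF.compact (kcnfOf k x))

/-- The head bits of the oracle answers. [folklore] -/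
def heads (as : List (List Bool)) : List Bool := as.map fun a => a.headD false

/-- **The step output as bits** (`Post.postOut` on the sparse formulas, the flag, the number of
answers received and their head bits). [folklore] -/
def stepBits (x : List Bool) (as : List (List Bool)) : List Bool :=
  Post.postOut (sparse k F x) (decide (Good k x)) as.length (heads as)

/-- The context handed to the later stages: flag, ticks, separator, head bits. [folklore] -/
theorem postIn_eq (Fs : List (KCNF k)) (g : Bool) (as : List (List Bool)) :
    (KCNF.encodeList Fs).map some ++ none :: some (Γ'.bit g) :: (ansCtx as).map cmap =
      Post.postIn Fs g as.length (heads as) := by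
  rw [map_cmap_ansCtx]
  simp [Post.postIn, Post.bt, heads, List.map_map, Function.comp_def]

/-- The answer transcript is at least twice the number of answers (plus two). [folklore] -/
theorem two_mul_length_le_transcript (as : List (List Bool)) :
    2 * as.length + 2 ≤ ((encodingList Bool).listBool.encode as).length := by
  rw [listBool_encode_answers]; simp

/-- Length of the answer context: `2 |as| + 1`. [folklore] -/
theorem length_ansCtx (as : List (List Bool)) : (ansCtx as).length = 2 * as.length + 1 := by
  simp [ansCtx]; omega

/-- **The step machine.** Given any machine computing a list-valued map `F` on `k`-CNFs
(`KCNF.encode φ ↦ KCNF.encodeList (F φ)`, time `T φ`), there is a `TM2` machine over `Bool` which on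
`⟨x, transcript⟩` outputs `stepBits k F x as` within `A (|x|+1)^A + A · T (compact (kcnfOf k x)) +
A · |transcript|` steps. [cite: ImpagliazzoPaturiZane2001, §2, Cor. 1–2 (the SERF reduction given by
sparsification); AroraBarak2009, §1.3] -/
theorem exists_stepMachine (T : KCNF k → ℕ)
    (hF : ∃ Ms : TM2ComputableAux Γ' Γ', ∀ φ : KCNF k, Ms.OutputsWithin φ.encode (KCNF.encodeList (F φ)) (T φ)) :
    ∃ (N : TM2ComputableAux Bool Bool) (A : ℕ), ∀ (x : List Bool) (as : List (List Bool)),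
      N.OutputsWithin (boolPair x ((encodingList Bool).listBool.encode as)) (stepBits k F x as)
        (A * (x.length + 1) ^ A + A * T (KCNF.compact (kcnfOf k x)) +
          A * ((encodingList Bool).listBool.encode as).length) := by
  classical
  -- the machines of the six stages
  obtain ⟨M0, h0⟩ := inT.timeComputable_eval
  obtain ⟨p, Mp, hp⟩ : ∃ (p : Polynomial ℕ) (Mp : TM2ComputableAux Bool Bool),
      ∀ z, Mp.OutputsWithin z (preFn k z) (p.eval z.length) := by
    obtain ⟨p, Mp, h⟩ := preFn_mem_FP k; exact ⟨p, Mp, h⟩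
  obtain ⟨M2, h2⟩ := midT.timeComputable_eval
  obtain ⟨cc, hcc⟩ := Compaction.kCNF_compact_computable_holds k
  obtain ⟨Mc, hMc⟩ := exists_computesInTime_iff.2 hcc
  obtain ⟨Ms, hMs⟩ := hF
  obtain ⟨M4, h4⟩ := Post.computesInTime k
  obtain ⟨M5, h5⟩ := outT.timeComputable_eval
  let M1 : TM2ComputableAux (Option Bool) (Option Bool) := TM2Ctx.ctxAux (A := Bool) Mp
  let M3 : TM2ComputableAux (Option Γ') (Option Γ') := TM2Ctx.ctxAux (A := Γ') (Mc.comp Ms)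
  let N : TM2ComputableAux Bool Bool := ((((M0.comp M1).comp M2).comp M3).comp M4).comp M5
  -- the constants
  set c0 := inT.maxEmit with hc0
  set c2 := midT.maxEmit with hc2
  set c5 := outT.maxEmit with hc5
  set Dp := TM2Comp.machinePushBound Mp.tm with hDp
  set Dc := TM2Comp.machinePushBound Mc.tm with hDc
  set Ds := TM2Comp.machinePushBound Ms.tm with hDs
  -- the polynomial part of the bound (opaque local functions, so that nothing unfolds them)
  obtain ⟨E, hEdef⟩ : ∃ E : List Bool → ℕ, E = fun x => (kcnfOf k x).encode.length := ⟨_, rfl⟩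
  obtain ⟨mc, hmcdef⟩ : ∃ mc : List Bool → ℕ, mc = fun x => cc * (E x + 1) ^ cc := ⟨_, rfl⟩
  obtain ⟨P, hPdef⟩ : ∃ P : List Bool → ℕ, P = fun x =>
    ((c0 + 1) * (2 * x.length + 2) + 3) +
    (2 * x.length + 2 + 2 * (x.length + Dp * p.eval x.length) + p.eval x.length + 8) +
    ((c2 + 1) * (x.length + Dp * p.eval x.length + 2) + 3) +
    (2 * E x + 4 + 2 * (E x + Dc * mc x) + mc x + 8) +
    (200 * (E x + Dc * mc x + 3) + 61) +
    ((c5 + 1) * (12 * (E x + Dc * mc x) + 3) + 3) := ⟨_, rfl⟩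
  have hE : PolyBd E := by
    refine ((PolyBd.length.const_mul 2).add_const 3).mono fun x => ?_
    rw [hEdef]; exact length_encode_kcnfOf_le k x
  have hmc : PolyBd mc := by rw [hmcdef]; exact (PolyBd.const cc).mul ((hE.add_const 1).pow cc)
  have hP : PolyBd P := by
    have hLn := PolyBd.length
    have hPe : PolyBd fun x => p.eval x.length := PolyBd.length.poly p
    have hT0 : PolyBd fun x => (c0 + 1) * (2 * x.length + 2) + 3 := (((hLn.const_mul 2).add_const 2).const_mul (c0 + 1)).add_const 3
    have hT1 : PolyBd fun x => 2 * x.length + 2 + 2 * (x.length + Dp * p.eval x.length) + p.eval x.length + 8 :=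
      (((((hLn.const_mul 2).add_const 2).add ((hLn.add (hPe.const_mul Dp)).const_mul 2)).add hPe).add_const 8)
    have hT2 : PolyBd fun x => (c2 + 1) * (x.length + Dp * p.eval x.length + 2) + 3 :=
      (((hLn.add (hPe.const_mul Dp)).add_const 2).const_mul (c2 + 1)).add_const 3
    have hT3 : PolyBd fun x => 2 * E x + 4 + 2 * (E x + Dc * mc x) + mc x + 8 :=
      ((((hE.const_mul 2).add_const 4).add ((hE.add (hmc.const_mul Dc)).const_mul 2)).add hmc).add_const 8
    have hT4 : PolyBd fun x => 200 * (E x + Dc * mc x + 3) + 61 :=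
      (((hE.add (hmc.const_mul Dc)).add_const 3).const_mul 200).add_const 61
    have hT5 : PolyBd fun x => (c5 + 1) * (12 * (E x + Dc * mc x) + 3) + 3 :=
      ((((hE.add (hmc.const_mul Dc)).const_mul 12).add_const 3).const_mul (c5 + 1)).add_const 3
    rw [hPdef]
    exact ((((hT0.add hT1).add hT2).add hT3).add hT4).add hT5
  obtain ⟨cP, hcP⟩ := hP
  obtain ⟨Cm, hCmdef⟩ : ∃ Cm : ℕ, Cm = 2 * Ds + 1 + 200 * Ds + (c5 + 1) * 12 * Ds := ⟨_, rfl⟩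
  obtain ⟨Ct, hCtdef⟩ : ∃ Ct : ℕ, Ct = (c0 + 1) + 4 + 2 * (c2 + 1) + 4 + 400 := ⟨_, rfl⟩
  refine ⟨N, max cP (max Cm Ct), fun x as => ?_⟩
  -- abbreviations
  set φ := kcnfOf k x with hφ
  set g := decide (Good k x) with hg
  set Tr := (encodingList Bool).listBool.encode as with hTr
  set C := ansCtx as with hC
  set Fs := F φ.compact with hFs
  -- stage 0: the input splitter
  have s0 : M0.OutputsWithin (boolPair x Tr) (x.map some ++ none :: C) ((c0 + 1) * (boolPair x Tr).length + 3) := by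
    have := h0 (boolPair x Tr)
    rwa [id, inT_eval] at this
  -- stage 1: the front end on the first field
  have s1 : M1.OutputsWithin (x.map some ++ none :: C) ((preFn k x).map some ++ none :: C)
      (2 * x.length + 2 * C.length + 2 * (preFn k x).length + p.eval x.length + 8) := ctx_outputsWithin Mp C (hp x)
  -- stage 2: the hand-over transducer
  have s2 : M2.OutputsWithin ((preFn k x).map some ++ none :: C)
      (φ.encode.map some ++ none :: (some (Γ'.bit g) :: C.map cmap))
      ((c2 + 1) * ((preFn k x).map some ++ none :: C).length + 3) := by
    have := h2 ((preFn k x).map some ++ none :: C)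
    rw [id, preFn_eq, midT_eval, ← encode_eq_kword] at this
    rwa [preFn_eq]
  -- stage 3: compaction and sparsifier on the first field
  have s3 : M3.OutputsWithin (φ.encode.map some ++ none :: (some (Γ'.bit g) :: C.map cmap))
      ((KCNF.encodeList Fs).map some ++ none :: (some (Γ'.bit g) :: C.map cmap))
      (2 * φ.encode.length + 2 * (some (Γ'.bit g) :: C.map cmap).length + 2 * (KCNF.encodeList Fs).length +
        (T φ.compact + cc * (φ.encode.length + 1) ^ cc) + 8) :=
    ctx_outputsWithin (Mc.comp Ms) _ (TM2ComputableAux.comp_outputsWithin Mc Ms (hMc φ) (hMs φ.compact))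
  -- stage 4: the back end
  have s4 : M4.OutputsWithin ((KCNF.encodeList Fs).map some ++ none :: (some (Γ'.bit g) :: C.map cmap))
      (bitsO (Post.postOut Fs g as.length (heads as)))
      (200 * (Post.postIn Fs g as.length (heads as)).length + 60 + 1) := by
    have := h4 ⟨Fs, g, as.length, heads as⟩
    dsimp only at this
    rwa [← postIn_eq] at this ⊢
  -- stage 5: the output projection
  have s5 : M5.OutputsWithin (bitsO (Post.postOut Fs g as.length (heads as))) (stepBits k F x as)
      ((c5 + 1) * (bitsO (Post.postOut Fs g as.length (heads as))).length + 3) := by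
    have := h5 (bitsO (Post.postOut Fs g as.length (heads as)))
    rwa [id, outT_eval] at this
  have H := TM2ComputableAux.comp_outputsWithin _ M5
    (TM2ComputableAux.comp_outputsWithin _ M4
      (TM2ComputableAux.comp_outputsWithin _ M3
        (TM2ComputableAux.comp_outputsWithin _ M2
          (TM2ComputableAux.comp_outputsWithin M0 M1 s0 s1) s2) s3) s4) s5
  refine H.mono ?_
  -- the lengths along the pipeline
  have lTr : 2 * as.length + 2 ≤ Tr.length := two_mul_length_le_transcript as
  have lC : C.length = 2 * as.length + 1 := length_ansCtx as
  have lpre : (preFn k x).length ≤ x.length + Dp * p.eval x.length := (hp x).length_le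
  have lE : φ.encode.length = E x := by rw [hEdef]
  have hmcx : mc x = cc * (E x + 1) ^ cc := by rw [hmcdef]
  have lu' : φ.compact.encode.length ≤ E x + Dc * mc x := by
    have := (hMc φ).length_le
    dsimp only at this
    rwa [lE, ← hDc, ← hmcx] at this
  have lY : (KCNF.encodeList Fs).length ≤ φ.compact.encode.length + Ds * T φ.compact := (hMs φ.compact).length_le
  have lIn := Post.length_postIn Fs g as.length (heads as)
  have lOut := Post.length_postOut_le Fs g as.length (heads as)
  have lheads : (heads as).length = as.length := List.length_map _
  rw [lheads] at lIn
  simp only [length_boolPair, List.length_append, List.length_map, List.length_cons, length_bitsO, lC, lE, lIn]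
  rw [← hmcx]
  -- stage by stage: polynomial part, sparsifier part, transcript part
  have b0 : (c0 + 1) * (2 * x.length + 2 + Tr.length) + 3 = ((c0 + 1) * (2 * x.length + 2) + 3) + (c0 + 1) * Tr.length := by
    ring
  have b1 : 2 * x.length + 2 * (2 * as.length + 1) + 2 * (preFn k x).length + p.eval x.length + 8 ≤
      (2 * x.length + 2 + 2 * (x.length + Dp * p.eval x.length) + p.eval x.length + 8) + 4 * Tr.length := by omega
  have b2 : (c2 + 1) * ((preFn k x).length + (2 * as.length + 1 + 1)) + 3 ≤
      ((c2 + 1) * (x.length + Dp * p.eval x.length + 2) + 3) + 2 * (c2 + 1) * Tr.length := by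
    have : (preFn k x).length + (2 * as.length + 1 + 1) ≤ (x.length + Dp * p.eval x.length + 2) + 2 * Tr.length := by omega
    calc (c2 + 1) * ((preFn k x).length + (2 * as.length + 1 + 1)) + 3
        ≤ (c2 + 1) * ((x.length + Dp * p.eval x.length + 2) + 2 * Tr.length) + 3 := by gcongr
      _ = ((c2 + 1) * (x.length + Dp * p.eval x.length + 2) + 3) + 2 * (c2 + 1) * Tr.length := by ring
  have b3 : 2 * E x + 2 * (2 * as.length + 1 + 1) + 2 * (KCNF.encodeList Fs).length + (T φ.compact + mc x) + 8 ≤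
      (2 * E x + 4 + 2 * (E x + Dc * mc x) + mc x + 8) + (2 * (Ds * T φ.compact) + T φ.compact) + 4 * Tr.length := by
    omega
  have b4 : 200 * ((KCNF.encodeList Fs).length + as.length + as.length + 3) + 60 + 1 ≤
      (200 * (E x + Dc * mc x + 3) + 61) + 200 * (Ds * T φ.compact) + 400 * Tr.length := by omega
  have b5 : (c5 + 1) * (Post.postOut Fs g as.length (heads as)).length + 3 ≤
      ((c5 + 1) * (12 * (E x + Dc * mc x) + 3) + 3) + (c5 + 1) * (12 * (Ds * T φ.compact)) := by
    have : (Post.postOut Fs g as.length (heads as)).length ≤ (12 * (E x + Dc * mc x) + 3) + 12 * (Ds * T φ.compact) := by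
      omega
    calc (c5 + 1) * (Post.postOut Fs g as.length (heads as)).length + 3
        ≤ (c5 + 1) * ((12 * (E x + Dc * mc x) + 3) + 12 * (Ds * T φ.compact)) + 3 := by gcongr
      _ = ((c5 + 1) * (12 * (E x + Dc * mc x) + 3) + 3) + (c5 + 1) * (12 * (Ds * T φ.compact)) := by ring
  have hsum : (2 * (Ds * T φ.compact) + T φ.compact) + 200 * (Ds * T φ.compact) + (c5 + 1) * (12 * (Ds * T φ.compact)) =
      Cm * T φ.compact := by
    rw [hCmdef]; ring
  have hτ : (c0 + 1) * Tr.length + 4 * Tr.length + 2 * (c2 + 1) * Tr.length + 4 * Tr.length + 400 * Tr.length =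
      Ct * Tr.length := by
    rw [hCtdef]; ring
  have hPx : P x ≤ max cP (max Cm Ct) * (x.length + 1) ^ max cP (max Cm Ct) :=
    (hcP x).trans (PolyBd.bound_mono (le_max_left _ _) _)
  have hCm : Cm * T φ.compact ≤ max cP (max Cm Ct) * T φ.compact :=
    Nat.mul_le_mul_right _ ((le_max_left _ _).trans (le_max_right _ _))
  have hCt : Ct * Tr.length ≤ max cP (max Cm Ct) * Tr.length :=
    Nat.mul_le_mul_right _ ((le_max_right _ _).trans (le_max_right _ _))
  have hPx' : P x = ((c0 + 1) * (2 * x.length + 2) + 3) +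
      (2 * x.length + 2 + 2 * (x.length + Dp * p.eval x.length) + p.eval x.length + 8) +
      ((c2 + 1) * (x.length + Dp * p.eval x.length + 2) + 3) + (2 * E x + 4 + 2 * (E x + Dc * mc x) + mc x + 8) +
      (200 * (E x + Dc * mc x + 3) + 61) + ((c5 + 1) * (12 * (E x + Dc * mc x) + 3) + 3) := by rw [hPdef]
  omega

end Literature.Computability.FineGrained.SerfKSat
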